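import Literature.NumberTheory.LFunctions.ZeroGaps
import Literature.NumberTheory.LFunctions.ZeroStatistics
import HarnessLib
import HarnessLib.Audit

/-!
# Barrier: spectral parameters of Bombieri–Garrett pseudo-Laplacians are rigidly spaced, so (on RH and pair correlation) at most 94% of the zeros of `ζ` can be eigenvalue parameters (Bombieri–Garrett 2020)

Barrier catalogue `Literature/Barriers/RiemannHypothesis/` (D-0021), entry `PseudoLaplacianSpacing`
(namespace `Literature.Barriers.RiemannHypothesis`; the catalogued declaration is `PseudoLaplacianSpacing`,
PROVED below as `PseudoLaplacianSpacing_holds`).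

## The technique (Hilbert–Pólya via pseudo-Laplacians; Bombieri–Garrett 2020, §1 and §4.1)

"Eigenvalues of self-adjoint operators are real. Thus, when parametrized as `λ_s = s(1−s) ∈ ℝ`,
either `Re(s) = 1/2` or `s ∈ ℝ` [`mul_one_sub_im_eq_zero_iff` below]. Thus, as apocryphally
suggested by G. Polya and by D. Hilbert, one might imagine proving the Riemann Hypothesis by finding
a self-adjoint operator such that, for every non-trivial zero `s` of `ζ(s)`, `λ_s` is an
eigenvalue." (§1.) The operators in question: for `θ` in the Eisenstein–Sobolev space `E^{−1}`
with `θ̄ = θ`, `θ ∉ E^0`, "let `S_θ` be `−Δ` restricted to the domain `E^∞_c ∩ ker θ` … The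
pseudo-Laplacian `S̃_θ` is the Friedrichs extension of `S_θ`" (§4.1), after Colin de Verdière
(1982–83) and Lax–Phillips. "Corollary 11. The discrete spectrum `λ_w > 1/4` of `S̃_θ`, if any, is
of the form `w(1−w)` for `w ∈ 1/2 + iℝ` such that `Eθ(w) = 0`". For the Eisenstein–Heegner
distribution `θ_d` (§3.6: the sum of automorphic Dirac deltas over the Heegner points of a
fundamental discriminant `d < −4`), `θ_d E_s = (√|d|/2)^s ζ(s)L(s,χ_d)/ζ(2s)`, i.e. "take
`θ ∈ E^{−1}` such that `θE_w = a_k^w ζ_k(w)/ζ(2w)`" (§1): "given a complex quadratic extension `k`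
of `ℚ`, we give a natural self-adjoint extension of a restriction of the invariant Laplacian on the
modular curve whose discrete spectrum, if any, consists of values `s(s−1)` for zeros `s` of
`ζ_k(s)`" (abstract).

## The obstruction (what this file vendors)

* **Theorem 67.** "Given `ε > 0`, there is `T_o > 0` sufficiently large such that, for two zeros
  `w₁ = 1/2 + iτ₁` and `w₂ = 1/2 + iτ₂` of `θE_w` with `T_o < τ₁ < τ₂`, if `θu_{θ,w₁} ≥ θu_{θ,w₂}`,
  then we have the lower bound `|τ₂ − τ₁| ≥ (1−ε)π/log τ₁`." **Corollary 68** (the case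
  `θu_{θ,w₁} = 0 = θu_{θ,w₂}`, which is the eigenvalue condition): "the discrete spectrum, if any,
  of `S̃_θ`, is `λ_{w_j}` with a lower bound `|w_{j+1} − w_j| ≥ (1−ε)π/log T` for adjacent `w_j` and
  `w_{j+1}` at height `T`." The mechanism (§7.3–7.4): interleaving — "There is at most one `w` on
  `Re(w) = 1/2` between adjacent zeros `s_j` and `s_{j+1}` of `a^s + c_s a^{1−s}`" (Cor. 62) — and
  the regularity of `arg ξ(1+2it)` from Titchmarsh (5.17.4), which makes consecutive zeros of
  `a^s + c_s a^{1−s}` lie between `(1−ε)π/log t` and `(1+ε)π/log t` apart (Cor. 64).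
  Vendored as the explicit class `BGSpacing S` of subsets `S ⊆ ℝ` having the conclusion of
  Theorem 67 / Corollary 68; that the set of spectral parameters of every such `S̃_θ` lies in this
  class is the content of Cor. 68 and is recorded here only in prose (the operators `S̃_θ` —
  Friedrichs extensions on spaces of automorphic forms — are not formalised).
* **§7.5, Corollary 69** ("assuming the Riemann Hypothesis and pair correlation"): "At most 94% of
  the zeros of `ζ(s)` give eigenvalues `λ_s = s(1−s)` for `S̃_θ`." "Remark 70. This shows that the
  optimistic simple version of the conjecture at the end of [CdV-pseudo] cannot hold. Namely, with
  `θ` the Eisenstain-Dirac `δ` at `e^{2πi/3}`, it cannot be the case that all zeros `ρ_j` of `ζ(s)`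
  give eigenvalues for `S̃_θ`." The input taken from pair correlation: "the asymptotic fraction of
  pairs of zeros within half the average spacing `2π/log T` up to height `T` is
  `∫₀^{1/2} (1 − (sin πu/πu)²) du ≈ 0.11315 > 0`. From the lower bound in the previous section, for
  at least one of every such pair `(m,n)` the corresponding zero cannot appear among discrete
  spectrum parameters `w` for `S̃_θ`." Vendored: the small-gap input as the explicit hypothesis
  `SmallGapsBelowHalfSpacing` (a positive proportion of consecutive distinct ordinates are at most
  `μ < 1/2` mean spacings `2π/log γ_n` apart, in the idiom of the tree's
  `Literature.NumberTheory.LFunctions.selberg_fujii_small_gaps`), and the PROVED exclusion statement `PseudoLaplacianSpacing`: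
  under that hypothesis every `BGSpacing` set misses one of `γ_n, γ_{n+1}` for a positive
  proportion of `n < N(T)`. The hypothesis itself is derived from Montgomery's pair correlation
  conjecture (`Literature.NumberTheory.LFunctions.MontgomeryPairCorrelation`) in the companion
  `PseudoLaplacianSpacingProofs.lean` (`SmallGapsBelowHalfSpacing.of_pairCorrelation`), which also
  records Corollary 69 / Remark 70 on pair correlation alone.

## References

* [BombieriGarrett2020] E. Bombieri, P. Garrett, *Designed pseudo-Laplacians*, arXiv:2002.07929
  (2020) (read: abstract, §1, §4.1 with Thm. 10–Cor. 11 and Remarks 12–14, §7.3–§7.5 with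
  Cor. 59–62, Cor. 64, Thm. 65, Thm. 67, Cor. 68, Cor. 69, Remarks 70–71; references).
* [ColinDeVerdiere1983] Y. Colin de Verdière, *Pseudo-laplaciens I, II*, Ann. Inst. Fourier 32
  (1982), 275–286; 33 (1983), 87–113 (cited through the previous item, as [CdV-pseudo]).
* [Montgomery1973] H. L. Montgomery, *The pair correlation of zeros of the zeta function*, Proc.
  Symp. Pure Math. 24 (1973), 181–193 (the tree's `Literature.NumberTheory.LFunctions.MontgomeryPairCorrelation`).
* [Titchmarsh1986] E. C. Titchmarsh, *The Theory of the Riemann Zeta-Function*, 2nd ed., §9.25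
  (the tree's `Literature.NumberTheory.LFunctions.selberg_fujii_small_gaps`: some `μ < 1`, unconditionally).

## Design notes

* Ordinates, counting function and index sets are the tree's `Literature.NumberTheory.LFunctions.zetaOrdinate` (`γ_n`, with
  multiplicity), `Literature.NumberTheory.LFunctions.zetaZeroCount` (`N(T)`), `Literature.zeroIndexSet T = Finset.range (N T)` and
  `Literature.zetaNormalizedGap n = (γ_{n+1} − γ_n)/(2π/log γ_n)`; "positive proportion" is spelled as in
  `Literature/NumberTheory/LFunctions/ZeroGaps.lean`: `∃ A > 0, ∃ T₀, ∀ T ≥ T₀, A·N(T) ≤ #{…}`.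
* The two tree facts consumed by the proof, `Literature.NumberTheory.LFunctions.mem_zeroIndexSet_iff` (`n < N(T) ↔ γ_n ≤ T`) and
  `Literature.NumberTheory.LFunctions.tendsto_zetaZeroCount_atTop` (`N(T) → ∞`), are named-fact `Prop`s and enter as hypotheses.
* `BGSpacing` uses `log τ₁` (Theorem 67) rather than "`log T` at height `T`" (Corollary 68).
-/

noncomputable section

open Filter Topology Real

namespace Literature.Barriers.RiemannHypothesis

/-! ## The Hilbert–Pólya mechanism -/

/-- `Im (s(1−s)) = Im s · (1 − 2 Re s)`. [folklore] -/
theorem mul_one_sub_im (s : ℂ) : (s * (1 - s)).im = s.im * (1 - 2 * s.re) := by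
  simp only [Complex.mul_im, Complex.sub_re, Complex.one_re, Complex.sub_im, Complex.one_im]
  ring

/-- "when parametrized as `λ_s = s(1−s) ∈ ℝ`, either `Re(s) = 1/2` or `s ∈ ℝ`" — the reason a
self-adjoint operator with eigenvalues `λ_s` at the zeros would prove RH.
[cite: BombieriGarrett2020, §1] -/
theorem mul_one_sub_im_eq_zero_iff (s : ℂ) : (s * (1 - s)).im = 0 ↔ s.re = 1 / 2 ∨ s.im = 0 := by
  rw [mul_one_sub_im, mul_eq_zero]
  constructor
  · rintro (h | h)
    · exact Or.inr h
    · exact Or.inl (by linarith)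
  · rintro (h | h)
    · exact Or.inr (by rw [h]; ring)
    · exact Or.inl h

/-! ## The technique class: Bombieri–Garrett spacing -/

/-- **The Bombieri–Garrett spacing property** of a set `S ⊆ ℝ` (of "spectral parameters" `τ`,
`λ_{1/2+iτ}` an eigenvalue): for every `ε > 0` there is `T₀` such that any two elements
`T₀ < τ₁ < τ₂` of `S` satisfy `τ₂ − τ₁ ≥ (1 − ε)π / log τ₁` — the conclusion of Theorem 67 (case
`θu_{θ,w₁} = 0 = θu_{θ,w₂}`) and Corollary 68: "the discrete spectrum, if any, of `S̃_θ`, is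
`λ_{w_j}` with a lower bound `|w_{j+1} − w_j| ≥ (1−ε)π/log T` for adjacent `w_j` and `w_{j+1}` at
height `T`", for every pseudo-Laplacian `S̃_θ` attached to a finite real-linear combination `θ` of
Eisenstein–Heegner distributions. [cite: BombieriGarrett2020, Theorem 67 and Corollary 68] -/
def BGSpacing (S : Set ℝ) : Prop :=
  ∀ ε : ℝ, 0 < ε → ∃ T₀ : ℝ, ∀ τ₁ ∈ S, ∀ τ₂ ∈ S, T₀ < τ₁ → τ₁ < τ₂ →
    (1 - ε) * π / Real.log τ₁ ≤ τ₂ - τ₁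

/-- Subsets of `BGSpacing` sets are `BGSpacing`. [folklore] -/
theorem BGSpacing.mono {S S' : Set ℝ} (h : BGSpacing S) (hsub : S' ⊆ S) : BGSpacing S' := by
  intro ε hε
  obtain ⟨T₀, hT⟩ := h ε hε
  exact ⟨T₀, fun τ₁ h₁ τ₂ h₂ ↦ hT τ₁ (hsub h₁) τ₂ (hsub h₂)⟩

/-- The empty set (no discrete spectrum at all — "there appears to be no general assurance of
existence of any discrete spectrum whatsoever", Remark 13) is `BGSpacing`.
[cite: BombieriGarrett2020, Remark 13] -/
theorem bgSpacing_empty : BGSpacing ∅ := fun _ _ ↦ ⟨0, fun _ h ↦ h.elim⟩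

/-- The threshold in `BGSpacing` may be enlarged. [folklore] -/
theorem BGSpacing.exists_ge {S : Set ℝ} (h : BGSpacing S) {ε : ℝ} (hε : 0 < ε) (T : ℝ) :
    ∃ T₀ : ℝ, T ≤ T₀ ∧ ∀ τ₁ ∈ S, ∀ τ₂ ∈ S, T₀ < τ₁ → τ₁ < τ₂ →
      (1 - ε) * π / Real.log τ₁ ≤ τ₂ - τ₁ := by
  obtain ⟨T₀, hT⟩ := h ε hε
  exact ⟨max T T₀, le_max_left _ _, fun τ₁ h₁ τ₂ h₂ hlt ↦
    hT τ₁ h₁ τ₂ h₂ (lt_of_le_of_lt (le_max_right _ _) hlt)⟩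

/-! ## The small-gap input (from RH + pair correlation in Bombieri–Garrett §7.5) -/

/-- **Small gaps below half the mean spacing, for a positive proportion of zeros**: there are
`μ < 1/2`, `A > 0`, `T₀` such that for all `T ≥ T₀` at least `A·N(T)` indices `n < N(T)` have
`0 < (γ_{n+1} − γ_n)/(2π/log γ_n) ≤ μ`. Bombieri–Garrett's printed input, taken from the Riemann
Hypothesis and Montgomery's pair-correlation conjecture (the tree's `Literature.NumberTheory.LFunctions.MontgomeryPairCorrelation`),
is the pair count: "the asymptotic fraction of pairs of zeros within half the average spacing
`2π/log T` up to height `T` is `∫₀^{1/2}(1 − (sin πu/πu)²) du ≈ 0.11315 > 0`", used through "for at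
least one of every such pair `(m,n)` the corresponding zero cannot appear among discrete spectrum
parameters"; a pair `m < n` of distinct zeros within half the mean spacing contains the consecutive
pair `(m, m+1)` with the same property, which is the form stated here, in the idiom of the tree's
unconditional `Literature.NumberTheory.LFunctions.selberg_fujii_small_gaps` (which gives only some `μ < 1`). As a bare assertion
about the zeros this is OPEN (not known even on the Riemann Hypothesis); the passage from
Montgomery's pair correlation conjecture (`Literature.NumberTheory.LFunctions.MontgomeryPairCorrelation`)
to this statement is PROVED in the companion `PseudoLaplacianSpacingProofs.lean`
(`SmallGapsBelowHalfSpacing.of_pairCorrelation`, through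
`Literature.NumberTheory.LFunctions.MontgomeryPairCorrelation.smallGaps`, every scale `μ > 0`; RH is
not used there, the tree's conjecture being a statement about the ordinates).
[cite: BombieriGarrett2020, §7.5] -/
@[conjecture] def SmallGapsBelowHalfSpacing : Prop :=
  ∃ μ : ℝ, μ < 1 / 2 ∧ ∃ A : ℝ, 0 < A ∧ ∃ T₀ : ℝ, ∀ T : ℝ, T₀ ≤ T →
    A * (Literature.NumberTheory.LFunctions.zetaZeroCount T : ℝ) ≤
      (((Literature.NumberTheory.LFunctions.zeroIndexSet T).filter fun n ↦
        0 < Literature.NumberTheory.LFunctions.zetaNormalizedGap n ∧ Literature.NumberTheory.LFunctions.zetaNormalizedGap n ≤ μ).card : ℝ)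

/-! ## The barrier -/

/-- **Barrier `PseudoLaplacianSpacing` (Bombieri–Garrett 2020, Thm. 67, Cor. 68–69, Remark 70).**
No set `S` with the Bombieri–Garrett spacing property — in particular (Cor. 68) the set of spectral
parameters `τ` of the eigenvalues `λ_{1/2+iτ} > 1/4` of any pseudo-Laplacian `S̃_θ`, `θ` a finite
real-linear combination of Eisenstein–Heegner distributions — can contain both `γ_n` and `γ_{n+1}`
for more than a proportion `1 − A` of the indices `n < N(T)`, as soon as a positive proportion of
consecutive distinct ordinates are at most `μ < 1/2` mean spacings apart
(`SmallGapsBelowHalfSpacing`, which Bombieri–Garrett obtain from RH and pair correlation): "At most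
94% of the zeros of `ζ(s)` give eigenvalues `λ_s = s(1−s)` for `S̃_θ`" (Cor. 69); "it cannot be the
case that all zeros `ρ_j` of `ζ(s)` give eigenvalues for `S̃_θ`" (Remark 70); "Unless we believe
that a subset of on-the-line zeros of `ζ(s)` is naturally distinguished, this might suggest that
the discrete spectrum is empty" (Remark 71). PROVED below (`PseudoLaplacianSpacing_holds`); the
tree facts `Literature.NumberTheory.LFunctions.mem_zeroIndexSet_iff` and `Literature.NumberTheory.LFunctions.tendsto_zetaZeroCount_atTop` enter as hypotheses.

BARRIER (structured block, D-0021):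
- technique_class: Hilbert-Polya pseudo-Laplacian Friedrichs-extension Colin-de-Verdiere Lax-Phillips Eisenstein-Heegner-distribution self-adjoint-operator-on-automorphic-forms zeros-as-eigenvalues
- blocks: RiemannHypothesis via "finding a self-adjoint operator such that, for every non-trivial zero `s` of `ζ(s)`, `λ_s` is an eigenvalue" when the operator is a pseudo-Laplacian `S̃_θ` on `SL₂(ℤ)\ℌ` (Colin de Verdière's suggestion): its discrete spectrum `λ_w > 1/4` lies among the zeros of `Eθ` (`ζ_k`, Cor. 11) but is `BGSpacing` (Cor. 68), hence omits a positive proportion of the zeros under `SmallGapsBelowHalfSpacing` (this decl; ≤ 94% on RH + pair correlation, Cor. 69) [cite: BombieriGarrett2020, §1, Cor. 11, Cor. 68, Cor. 69, Remark 70]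
- because: between adjacent on-line zeros of the constant term `a^s + c_s a^{1−s}` of the truncated Eisenstein series there is at most one spectral parameter (interleaving, Cor. 59–62, from the exotic eigenfunction expansion `θv_{θ,w} = ∑_j |θ(f_j)|²/(λ_{s_j} − λ_w)`, strictly monotone in `τ`), and by the regularity of `arg ξ(1+2it)` [Titchmarsh (5.17.4)] those zeros are spaced between `(1−ε)π/log t` and `(1+ε)π/log t` (Cor. 64), movable by the cut-off `a` (Thm. 65–Cor. 66); so adjacent spectral parameters are `≥ (1−ε)π/log τ` apart (Thm. 67, Cor. 68), whereas pair correlation puts a positive proportion (≈ 0.113) of pairs of zeros within half the mean spacing `2π/log T` [cite: BombieriGarrett2020, §7.3–§7.5]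
- evasions_known: none published for all zeros; Bombieri–Garrett obtain instead unconditional positive results on spacing of on-line zeros of `ζ_k` from the same machinery (§8, Cor. 76–77) [cite: BombieriGarrett2020, §8]
- status: established for Thm. 67 / Cor. 68 (unconditional) and for the exclusion proved here; the "94%" (Cor. 69) is conditional on RH and Montgomery's pair-correlation conjecture [cite: BombieriGarrett2020, §7.5]
- scope_caveats: (i) only the pseudo-Laplacians `S̃_θ` of Bombieri–Garrett (Friedrichs extensions of restrictions of `−Δ` on Eisenstein–Sobolev spaces over `SL₂(ℤ)\ℌ`, `θ` a finite real combination of Eisenstein–Heegner distributions) are covered — not self-adjoint operators in general, so the Hilbert–Pólya idea as such is untouched [cite: BombieriGarrett2020, §1]; (ii) the step "spectral parameters of `S̃_θ` form a `BGSpacing` set" (Cor. 68) is cited, not formalised; (iii) the positive-proportion exclusion needs gaps below HALF the mean spacing, available only from RH + pair correlation [cite: BombieriGarrett2020, §7.5] — the unconditional Selberg–Fujii theorem (`Literature.NumberTheory.LFunctions.selberg_fujii_small_gaps`) gives only some `μ < 1` [cite: Titchmarsh1986, §9.25]; (iv) Cor. 11 allows the discrete spectrum to be empty, and nothing here excludes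 that a sparse subset of zeros are eigenvalue parameters [cite: BombieriGarrett2020, Remarks 13 and 71]; (v) the small-gap input is stated for consecutive distinct ordinates (`SmallGapsBelowHalfSpacing`); its derivation from Montgomery's pair correlation conjecture is proved in `PseudoLaplacianSpacingProofs.lean` (`SmallGapsBelowHalfSpacing.of_pairCorrelation`, `pseudoLaplacianSpacing_of_pairCorrelation`), while the figure "94%" is as printed, not formalised [cite: BombieriGarrett2020, §7.5]

[cite: BombieriGarrett2020, Theorem 67, Corollaries 68–69] -/
def PseudoLaplacianSpacing : Prop :=
  open scoped Classical in
  Literature.NumberTheory.LFunctions.mem_zeroIndexSet_iff → Literature.NumberTheory.LFunctions.tendsto_zetaZeroCount_atTop → SmallGapsBelowHalfSpacing →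
    ∀ S : Set ℝ, BGSpacing S →
      ∃ A : ℝ, 0 < A ∧ ∃ T₀ : ℝ, ∀ T : ℝ, T₀ ≤ T →
        A * (Literature.NumberTheory.LFunctions.zetaZeroCount T : ℝ) ≤
          (((Literature.NumberTheory.LFunctions.zeroIndexSet T).filter fun n ↦
            Literature.NumberTheory.LFunctions.zetaOrdinate n ∉ S ∨ Literature.NumberTheory.LFunctions.zetaOrdinate (n + 1) ∉ S).card : ℝ)

/-- **Pointwise exclusion** (the sentence "for at least one of every such pair the corresponding
zero cannot appear among discrete spectrum parameters"): if `S` is `BGSpacing` and `μ < 1/2`, then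
beyond some height every pair of consecutive distinct ordinates at most `μ` mean spacings apart has
a member outside `S`. [cite: BombieriGarrett2020, §7.5] -/
theorem BGSpacing.not_mem_or_not_mem {S : Set ℝ} (hS : BGSpacing S) {μ : ℝ} (hμ : μ < 1 / 2)
    (T : ℝ) : ∃ T₁ : ℝ, T ≤ T₁ ∧ ∀ n : ℕ, T₁ < Literature.NumberTheory.LFunctions.zetaOrdinate n → 0 < Literature.NumberTheory.LFunctions.zetaNormalizedGap n →
      Literature.NumberTheory.LFunctions.zetaNormalizedGap n ≤ μ → Literature.NumberTheory.LFunctions.zetaOrdinate n ∉ S ∨ Literature.NumberTheory.LFunctions.zetaOrdinate (n + 1) ∉ S := by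
  -- `ε := 1/2 − μ > 0`; then `2μ < 1 − ε = 1/2 + μ`
  obtain ⟨T₁, hT₁, hsp⟩ := hS.exists_ge (ε := 1 / 2 - μ) (by linarith) (max T 1)
  refine ⟨T₁, (le_max_left _ _).trans hT₁, fun n hn hpos hle ↦ ?_⟩
  by_contra hboth
  simp only [not_or, not_not] at hboth
  obtain ⟨h1, h2⟩ := hboth
  have hγ1 : 1 < Literature.NumberTheory.LFunctions.zetaOrdinate n := lt_of_le_of_lt ((le_max_right _ _).trans hT₁) hn
  have hlog : 0 < Real.log (Literature.NumberTheory.LFunctions.zetaOrdinate n) := Real.log_pos hγ1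
  have hsp_pos : 0 < 2 * π / Real.log (Literature.NumberTheory.LFunctions.zetaOrdinate n) := by positivity
  -- the gap is positive, so `γ_n < γ_{n+1}`
  have hgap : Literature.NumberTheory.LFunctions.zetaOrdinate (n + 1) - Literature.NumberTheory.LFunctions.zetaOrdinate n =
      Literature.NumberTheory.LFunctions.zetaNormalizedGap n * (2 * π / Real.log (Literature.NumberTheory.LFunctions.zetaOrdinate n)) :=
    Literature.NumberTheory.LFunctions.zetaOrdinate_succ_sub_eq n hlog.ne'
  have hlt : Literature.NumberTheory.LFunctions.zetaOrdinate n < Literature.NumberTheory.LFunctions.zetaOrdinate (n + 1) := by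
    have : 0 < Literature.NumberTheory.LFunctions.zetaOrdinate (n + 1) - Literature.NumberTheory.LFunctions.zetaOrdinate n := by rw [hgap]; positivity
    linarith
  have hBG := hsp _ h1 _ h2 hn hlt
  -- `(1/2 + μ) π / log γ_n ≤ gap ≤ μ · 2π / log γ_n`
  rw [hgap] at hBG
  have hle' : Literature.NumberTheory.LFunctions.zetaNormalizedGap n * (2 * π / Real.log (Literature.NumberTheory.LFunctions.zetaOrdinate n)) ≤
      μ * (2 * π / Real.log (Literature.NumberTheory.LFunctions.zetaOrdinate n)) :=
    mul_le_mul_of_nonneg_right hle hsp_pos.le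
  have key : (1 - (1 / 2 - μ)) * π / Real.log (Literature.NumberTheory.LFunctions.zetaOrdinate n) ≤
      μ * (2 * π / Real.log (Literature.NumberTheory.LFunctions.zetaOrdinate n)) := hBG.trans hle'
  rw [div_le_iff₀ hlog, mul_assoc, div_mul_cancel₀ _ hlog.ne'] at key
  nlinarith [mul_pos (show (0 : ℝ) < 1 / 2 - μ by linarith) Real.pi_pos]

/-- **The barrier holds** (counting version of the previous lemma). [cite: BombieriGarrett2020, Corollary 69] -/
theorem PseudoLaplacianSpacing_holds : PseudoLaplacianSpacing := by
  intro hmem hN hsmall S hS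
  obtain ⟨μ, hμ, A, hA, T₀, hcount⟩ := hsmall
  obtain ⟨T₁, -, hexcl⟩ := hS.not_mem_or_not_mem hμ 0
  classical
  -- the exceptional indices `γ_n ≤ T₁` number at most `N(T₁)`
  set C : ℕ := Literature.NumberTheory.LFunctions.zetaZeroCount T₁ with hC
  -- choose `T₂` with `N(T) ≥ 2C/A` for `T ≥ T₂`
  have hev : ∀ᶠ T in atTop, 2 * (C : ℝ) / A ≤ (Literature.NumberTheory.LFunctions.zetaZeroCount T : ℝ) := by
    have h1 : Tendsto (fun T ↦ (Literature.NumberTheory.LFunctions.zetaZeroCount T : ℝ)) atTop atTop :=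
      tendsto_natCast_atTop_atTop.comp hN
    exact h1.eventually_ge_atTop _
  obtain ⟨T₂, hT₂⟩ := eventually_atTop.1 hev
  refine ⟨A / 2, by positivity, max T₀ T₂, fun T hT ↦ ?_⟩
  have hT0 : T₀ ≤ T := (le_max_left _ _).trans hT
  have hT2 : T₂ ≤ T := (le_max_right _ _).trans hT
  -- small-gap indices split into excluded ones and low ones
  have hsubset : ((Literature.NumberTheory.LFunctions.zeroIndexSet T).filter fun n ↦
        0 < Literature.NumberTheory.LFunctions.zetaNormalizedGap n ∧ Literature.NumberTheory.LFunctions.zetaNormalizedGap n ≤ μ) ⊆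
      ((Literature.NumberTheory.LFunctions.zeroIndexSet T).filter fun n ↦ Literature.NumberTheory.LFunctions.zetaOrdinate n ∉ S ∨ Literature.NumberTheory.LFunctions.zetaOrdinate (n + 1) ∉ S) ∪
        Literature.NumberTheory.LFunctions.zeroIndexSet T₁ := by
    intro n hn
    rw [Finset.mem_filter] at hn
    obtain ⟨hnT, hpos, hle⟩ := hn
    rw [Finset.mem_union, Finset.mem_filter]
    by_cases hlow : Literature.NumberTheory.LFunctions.zetaOrdinate n ≤ T₁
    · exact Or.inr (hmem.2 hlow)
    · exact Or.inl ⟨hnT, hexcl n (lt_of_not_ge hlow) hpos hle⟩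
  have hcard := Finset.card_le_card hsubset
  have hcard' := (hcard.trans (Finset.card_union_le _ _))
  rw [Literature.NumberTheory.LFunctions.card_zeroIndexSet] at hcard'
  have h1 := hcount T hT0
  have h2 := hT₂ T hT2
  have h3 : (((Literature.NumberTheory.LFunctions.zeroIndexSet T).filter fun n ↦
        0 < Literature.NumberTheory.LFunctions.zetaNormalizedGap n ∧ Literature.NumberTheory.LFunctions.zetaNormalizedGap n ≤ μ).card : ℝ) ≤
      (((Literature.NumberTheory.LFunctions.zeroIndexSet T).filter fun n ↦
        Literature.NumberTheory.LFunctions.zetaOrdinate n ∉ S ∨ Literature.NumberTheory.LFunctions.zetaOrdinate (n + 1) ∉ S).card : ℝ) + C := by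
    exact_mod_cast hcard'
  -- `A N ≤ #bad + C` and `C ≤ (A/2) N`
  have h4 : (C : ℝ) ≤ A / 2 * (Literature.NumberTheory.LFunctions.zetaZeroCount T : ℝ) := by
    rw [div_le_iff₀ hA] at h2
    linarith
  linarith

/-- In particular no `BGSpacing` set contains all ordinates beyond any height (given the two
tree facts and the small-gap input). [cite: BombieriGarrett2020, Remark 70] -/
theorem BGSpacing.exists_not_mem (hmem : Literature.NumberTheory.LFunctions.mem_zeroIndexSet_iff)
    (hN : Literature.NumberTheory.LFunctions.tendsto_zetaZeroCount_atTop) (hsmall : SmallGapsBelowHalfSpacing) {S : Set ℝ}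
    (hS : BGSpacing S) (T : ℝ) : ∃ n : ℕ, T < Literature.NumberTheory.LFunctions.zetaOrdinate n ∧ Literature.NumberTheory.LFunctions.zetaOrdinate n ∉ S := by
  classical
  obtain ⟨A, hA, T₀, hAT⟩ := PseudoLaplacianSpacing_holds hmem hN hsmall S hS
  -- eventually `A · N(T') ≥ N(T) + 1`
  have hev : ∀ᶠ T' in atTop, (Literature.NumberTheory.LFunctions.zetaZeroCount T : ℝ) + 1 ≤ A * (Literature.NumberTheory.LFunctions.zetaZeroCount T' : ℝ) :=
    ((tendsto_natCast_atTop_atTop.comp hN).const_mul_atTop hA).eventually_ge_atTop _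
  obtain ⟨T', h1, h2⟩ := (hev.and (eventually_ge_atTop T₀)).exists
  have h3 := hAT T' h2
  -- so the excluded indices below `T'` are not all of height `≤ T`
  have h4 : ¬ ((Literature.NumberTheory.LFunctions.zeroIndexSet T').filter fun n ↦
      Literature.NumberTheory.LFunctions.zetaOrdinate n ∉ S ∨ Literature.NumberTheory.LFunctions.zetaOrdinate (n + 1) ∉ S) ⊆ Literature.NumberTheory.LFunctions.zeroIndexSet T := by
    intro hsub
    have h5 := Finset.card_le_card hsub
    rw [Literature.NumberTheory.LFunctions.card_zeroIndexSet] at h5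
    have h6 : (((Literature.NumberTheory.LFunctions.zeroIndexSet T').filter fun n ↦
        Literature.NumberTheory.LFunctions.zetaOrdinate n ∉ S ∨ Literature.NumberTheory.LFunctions.zetaOrdinate (n + 1) ∉ S).card : ℝ) ≤ Literature.NumberTheory.LFunctions.zetaZeroCount T := by
      exact_mod_cast h5
    linarith
  obtain ⟨n, hn, hnT⟩ := Finset.not_subset.1 h4
  rw [Finset.mem_filter] at hn
  have hγn : T < Literature.NumberTheory.LFunctions.zetaOrdinate n := lt_of_not_ge fun h ↦ hnT (hmem.2 h)
  rcases hn.2 with h | h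
  · exact ⟨n, hγn, h⟩
  · refine ⟨n + 1, lt_of_not_ge fun h' ↦ hnT ?_, h⟩
    -- `n + 1 ∈ zeroIndexSet T ⇒ n ∈ zeroIndexSet T` (an initial segment of `ℕ`)
    have h5 : n + 1 ∈ Literature.NumberTheory.LFunctions.zeroIndexSet T := hmem.2 h'
    rw [Literature.NumberTheory.LFunctions.zeroIndexSet, Finset.mem_range] at h5 ⊢
    omega

end Literature.Barriers.RiemannHypothesis
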